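import Literature.MathematicalPhysics.QuantumLattice.HubbardWindowCertificate
import HarnessLib

/-!
# Window certificates for the square-lattice Hubbard model with POINT-GROUP (`D₄`) reductions

Family `hubbard` (topic `MathematicalPhysics/QuantumLattice`). Companion of
`HubbardWindowCertificate`: there the symmetry identifications of a thermodynamic-limit
("reduce"-mode) certificate were lattice TRANSLATIONS `τ_v`. Han's 2D bootstrap (arXiv:2006.06002
(2020) §3, constraint `F[U⁻¹ O U] = F[O]` for `U ∈ {T_(1,0), T_(0,1), Π, R}`) and the certificates
of the bundle papers/HubbardSuperconductivity/manybody-bootstrap/ (`hypotheses.reduce.point_group`)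
also identify a monomial with its images under the point group of the square lattice. Here, for
`d = 2`, the symmetry family is the AFFINE `D₄` maps `x ↦ γ·x + w` of `ℤ²` (`γ ∈ D₄` acting by
`d4Vec`, tree `FockRelabel`; `w ∈ ℤ²`; translations are `γ = 1`), realised on the window by the
site embeddings `PolySite.d4Emb γ w Λ : Λ ↪ γΛ + w` and on every torus `(ℤ/Lℤ)²` by the unitaries
`U_{w mod L} D_γ` (`fockTranslate`, `fockD4`; `Torus.proj_d4Vec`), which commute with the Hubbard
Hamiltonian and preserve the sectors. The pull-back dictionary
`Γ(ι_{γΛ+w})(Γ(d4Emb) A) = U_w D_γ (Γ(ι_Λ) A) (U_w D_γ)ᴴ` (`fermionEmbed_toTorusEmb_d4Emb`) turns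
each window term `Γ(incl)(Γ(d4Emb γ w) Y) − Γ(incl) Y` into a symmetry defect of the tracial sector
ground state, whence the window theorem with point-group reductions
(`groundEnergyAt_div_ge_of_window_certificate_d4`) and its thermodynamic-limit corollary
(`energyDensity2D_ge_of_window_certificate_d4`). Everything is PROVED; the definitions are the
bookkeeping region `d4ShiftSet` and embedding `PolySite.d4Emb`.

## References
* X. Han, *Quantum many-body bootstrap*, arXiv:2006.06002 (2020), §2 eq. (2), §3 (symmetries
  `T_(1,0), T_(0,1), Π, R` of the square lattice). [cite: Han2020Bootstrap, §3]
* D. J. Scalapino, Phys. Rep. 250 (1995) 329, §2 (square-lattice point group `C₄ᵥ ≅ D₄`).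
  [cite: Scalapino1995, §2]
* O. Bratteli, D. W. Robinson, *Operator Algebras and Quantum Statistical Mechanics II*, 2nd ed.,
  §5.2.2, Thm. 5.2.5 (Bogoliubov automorphisms of one-particle bijections). [cite: BratteliRobinsonII1997, §5.2.2]
-/

noncomputable section

namespace Literature.MathematicalPhysics.QuantumLattice

open Matrix Finset HubbardWave0 Literature.Probability.LatticeModels
open Literature.MathematicalPhysics.QuantumManyBody.StateRelaxation
open scoped ComplexOrder BigOperators

/-! ### Affine `D₄` maps of `ℤ²` on regions -/

section Regions

/-- The image region `γΛ + w = {γ·x + w : x ∈ Λ}` of an affine `D₄` map. [cite: Scalapino1995, §2] -/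
def d4ShiftSet (γ : DihedralGroup 4) (w : Site 2) (Λ : Finset (Site 2)) : Finset (Site 2) :=
  Λ.map ⟨fun x => d4Vec γ x + w, fun _ _ h => d4Vec_injective γ (add_right_cancel h)⟩

/-- `γ·x + w ∈ γΛ + w` for `x ∈ Λ`. [folklore] -/
theorem d4Vec_add_mem_d4ShiftSet (γ : DihedralGroup 4) (w : Site 2) {Λ : Finset (Site 2)} {x : Site 2}
    (hx : x ∈ Λ) : d4Vec γ x + w ∈ d4ShiftSet γ w Λ :=
  Finset.mem_map.2 ⟨x, hx, rfl⟩

/-- **The affine `D₄` map of a region as an injection of ordered site sets**, `x ↦ γ·x + w` from the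
sites of `Λ` to those of `γΛ + w`. [cite: Scalapino1995, §2] -/
def PolySite.d4Emb (γ : DihedralGroup 4) (w : Site 2) (Λ : Finset (Site 2)) :
    PolySite Λ ↪ PolySite (d4ShiftSet γ w Λ) :=
  ⟨fun y => PolySite.pt (d4Vec γ (ofLex y.1) + w) (d4Vec_add_mem_d4ShiftSet γ w (PolySite.ofLex_mem y)),
    fun y y' hy => by
      have h : d4Vec γ (ofLex y.1) + w = d4Vec γ (ofLex y'.1) + w :=
        congrArg (fun z : PolySite (d4ShiftSet γ w Λ) => ofLex z.1) hy
      exact Subtype.ext (congrArg toLex (d4Vec_injective γ (add_right_cancel h)))⟩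

/-- The underlying site of `d4Emb γ w Λ y`. [folklore] -/
@[simp] theorem PolySite.ofLex_coe_d4Emb (γ : DihedralGroup 4) (w : Site 2) {Λ : Finset (Site 2)}
    (y : PolySite Λ) : ofLex (PolySite.d4Emb γ w Λ y).1 = d4Vec γ (ofLex y.1) + w := rfl

/-- `Torus.proj` is additive. [folklore] -/
private theorem proj_add_d4 (L : ℕ) (x y : Site 2) :
    Torus.proj L (x + y) = Torus.proj L x + Torus.proj L y := by
  funext i
  simp [Torus.proj]

end Regions

/-! ### The pull-back dictionary for affine `D₄` maps -/

section Torus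

variable {L : ℕ} [NeZero L]

/-- (Local to this file, as in `HubbardWindowCertificate`.) [folklore] -/
local instance (priority := high) instDecidableEqFermionTorusD4 : DecidableEq (FermionTorus 2 L) :=
  LinearOrder.toDecidableEq

/-- **Pulling the `D₄`-image of a region back into the torus is the torus point-group image of the
pull-back**: `Γ(ι_{γΛ+w,L})(Γ(d4Emb γ w) A) = T_{w mod L} (D_γ (Γ(ι_{Λ,L}) A))` with `T`, `D` the
translation / `D₄` Bogoliubov automorphisms (`relabel (Orb.translate _)`, `relabel (Orb.d4Perm _)`).
[cite: BratteliRobinsonII1997, §5.2.2, Thm. 5.2.5] -/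
theorem fermionEmbed_toTorusEmb_d4Emb (γ : DihedralGroup 4) (w : Site 2) {Λ : Finset (Site 2)}
    (h : Set.InjOn (Torus.proj (d := 2) L) ↑Λ)
    (h' : Set.InjOn (Torus.proj (d := 2) L) ↑(d4ShiftSet γ w Λ)) (A : FermionOp Λ) :
    fermionEmbed (PolySite.toTorusEmb L h') (fermionEmbed (PolySite.d4Emb γ w Λ) A) =
      relabel (Orb.translate (Torus.proj L w))
        (relabel (Orb.d4Perm γ) (fermionEmbed (PolySite.toTorusEmb L h) A)) := by
  have key : (PolySite.d4Emb γ w Λ).trans (PolySite.toTorusEmb L h') =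
      (PolySite.toTorusEmb L h).trans
        ((FermionTorus.ofTorusEquiv (d4SitePerm (L := L) γ)).trans
          (FermionTorus.ofTorusEquiv (Equiv.addRight (Torus.proj L w)))).toEmbedding := by
    refine DFunLike.ext _ _ fun y => ?_
    rw [Function.Embedding.trans_apply, Function.Embedding.trans_apply, PolySite.toTorusEmb_apply,
      PolySite.toTorusEmb_apply, Equiv.coe_toEmbedding, Equiv.trans_apply,
      FermionTorus.ofTorusEquiv_ofTorusSite, FermionTorus.ofTorusEquiv_ofTorusSite, d4SitePerm_apply,
      Equiv.coe_addRight, PolySite.ofLex_coe_d4Emb, proj_add_d4, Torus.proj_d4Vec]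
  rw [fermionEmbed_fermionEmbed, key, ← fermionEmbed_fermionEmbed, fermionEmbed_equiv, Orb.mapEquiv_trans]
  show relabel ((Orb.mapEquiv (FermionTorus.ofTorusEquiv (d4SitePerm (L := L) γ))).trans
      (Orb.mapEquiv (FermionTorus.ofTorusEquiv (Equiv.addRight (Torus.proj L w))))) _ = _
  rw [relabel_trans]
  rfl

/-- The torus unitary of the affine map `x ↦ γx + w`: `U_w D_γ`. Its conjugation action is
`T_w ∘ D_γ`. [folklore] -/
theorem d4Affine_conj (γ : DihedralGroup 4) (w : TorusSite 2 L)
    (Z : Matrix (Finset (Orb (FermionTorus 2 L))) (Finset (Orb (FermionTorus 2 L))) ℂ) :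
    (fockTranslate w).val * (fockD4 (L := L) γ).val * Z * ((fockTranslate w).val * (fockD4 (L := L) γ).val)ᴴ =
      relabel (Orb.translate w) (relabel (Orb.d4Perm γ) Z) := by
  rw [relabel_eq_fockRelabel_conj, relabel_eq_fockRelabel_conj, fockD4_apply, conjTranspose_mul]
  simp only [Matrix.mul_assoc]

/-- `U_w D_γ` commutes with the Hubbard Hamiltonian of the square torus. [cite: Scalapino1995, §2] -/
theorem d4Affine_mul_hubbardTorus (γ : DihedralGroup 4) (w : TorusSite 2 L) (t U : ℝ) :
    (fockTranslate w).val * (fockD4 (L := L) γ).val * hubbardTorus 2 L t U =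
      hubbardTorus 2 L t U * ((fockTranslate w).val * (fockD4 (L := L) γ).val) := by
  rw [Matrix.mul_assoc, (fockD4_commute_hubbardTorus γ t U).eq, ← Matrix.mul_assoc,
    (fockTranslate_commute_hubbardTorus w t U).eq, Matrix.mul_assoc]

/-- `U_w D_γ` preserves the joint sectors. [folklore] -/
theorem d4Affine_mulVec_mem_szSector (γ : DihedralGroup 4) (w : TorusSite 2 L) {N : ℕ} {M : ℝ}
    {ψ : Fock (Orb (FermionTorus 2 L))} (hψ : ψ ∈ szSector N M) :
    ((fockTranslate w).val * (fockD4 (L := L) γ).val) *ᵥ ψ ∈ szSector N M := by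
  rw [← mulVec_mulVec]
  exact fockTranslate_mulVec_mem_szSector w (fockD4_mulVec_mem_szSector γ hψ)

/-- `(D_γ)ᴴ = D_{γ⁻¹}`. [folklore] -/
theorem fockD4_val_conjTranspose (γ : DihedralGroup 4) :
    (fockD4 (L := L) γ).valᴴ = (fockD4 (L := L) γ⁻¹).val := by
  rw [map_inv]
  rfl

/-- `(U_w D_γ)ᴴ` preserves the joint sectors. [folklore] -/
theorem d4Affine_conjTranspose_mulVec_mem_szSector (γ : DihedralGroup 4) (w : TorusSite 2 L) {N : ℕ}
    {M : ℝ} {ψ : Fock (Orb (FermionTorus 2 L))} (hψ : ψ ∈ szSector N M) :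
    ((fockTranslate w).val * (fockD4 (L := L) γ).val)ᴴ *ᵥ ψ ∈ szSector N M := by
  rw [conjTranspose_mul, fockD4_val_conjTranspose, fockTranslate_val_conjTranspose, ← mulVec_mulVec]
  exact fockD4_mulVec_mem_szSector γ⁻¹ (fockTranslate_mulVec_mem_szSector (-w) hψ)

/-- `(U_w D_γ)ᴴ (U_w D_γ) = 1`. [folklore] -/
theorem d4Affine_conjTranspose_mul_self (γ : DihedralGroup 4) (w : TorusSite 2 L) :
    ((fockTranslate w).val * (fockD4 (L := L) γ).val)ᴴ * ((fockTranslate w).val * (fockD4 (L := L) γ).val) = 1 := by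
  have hD : (fockD4 (L := L) γ).valᴴ * (fockD4 (L := L) γ).val = 1 := by
    have h := fockRelabel_conjTranspose_mul_self (Orb.d4Perm (L := L) γ)
    rw [← fockRelabel_val] at h
    exact h
  rw [conjTranspose_mul, Matrix.mul_assoc, ← Matrix.mul_assoc ((fockTranslate w).val)ᴴ,
    fockTranslate_conjTranspose_mul_self, Matrix.one_mul, hD]

/-- **Affine `D₄` differences in the window become symmetry defects on the torus**:
`Γ(ι_{Λ'})(Γ(incl)(Γ(d4Emb γ w) Y) − Γ(incl) Y) = V (Γ(ι_Λ) Y) Vᴴ − Γ(ι_Λ) Y`, `V = U_{w mod L} D_γ`.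
Han 2020 §3 (`F[U⁻¹ O U] = F[O]`, `U ∈ {T, Π, R}`). [cite: Han2020Bootstrap, §3] -/
theorem fermionEmbed_toTorusEmb_d4_sub {Λ Λ' : Finset (Site 2)} (hΛ : Λ ⊆ Λ') (γ : DihedralGroup 4)
    (w : Site 2) (hsh : d4ShiftSet γ w Λ ⊆ Λ') (hInj' : Set.InjOn (Torus.proj (d := 2) L) ↑Λ')
    (Y : FermionOp Λ) :
    fermionEmbed (PolySite.toTorusEmb L hInj')
        (fermionEmbed (PolySite.incl hsh) (fermionEmbed (PolySite.d4Emb γ w Λ) Y) -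
          fermionEmbed (PolySite.incl hΛ) Y) =
      (fockTranslate (Torus.proj L w)).val * (fockD4 (L := L) γ).val *
          fermionEmbed (PolySite.toTorusEmb L (hInj'.mono (by exact_mod_cast hΛ))) Y *
          ((fockTranslate (Torus.proj L w)).val * (fockD4 (L := L) γ).val)ᴴ -
        fermionEmbed (PolySite.toTorusEmb L (hInj'.mono (by exact_mod_cast hΛ))) Y := by
  rw [map_sub, fermionEmbed_toTorusEmb_incl hsh hInj', fermionEmbed_toTorusEmb_incl hΛ hInj',
    fermionEmbed_toTorusEmb_d4Emb γ w (hInj'.mono (by exact_mod_cast hΛ)) (hInj'.mono (by exact_mod_cast hsh)) Y,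
    d4Affine_conj]

end Torus

/-! ### The window certificate with point-group reductions -/

section Window

variable {L : ℕ} [NeZero L]

/-- (Local to this section.) [folklore] -/
local instance (priority := high) instDecidableEqFermionTorusD4' : DecidableEq (FermionTorus 2 L) :=
  LinearOrder.toDecidableEq

/-- **Window certificate with affine `D₄` reductions ⇒ energy per site of a square torus.** As
`groundEnergyAt_div_ge_of_window_certificate` (HubbardWindowCertificate), in `d = 2`, with the
symmetry family of AFFINE `D₄` maps `x ↦ γₗ x + wₗ` (translations: `γₗ = 1`): the window identity
`Γ(incl) E_Φ − c·1 − Σ_σ μ_σ (n_{0σ} − ν·1) = Σ Λₐᵦ Oₐᴴ O_b + (Σₖ (H_{Λ'} Bₖ − Bₖ H_{Λ'})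
   + Σₗ (Γ(incl)(Γ(d4Emb γₗ wₗ) Yₗ) − Γ(incl) Yₗ) + Σⱼ bⱼ • wⱼ) + (Σₘ dₘ • (Vₘᴴ − Vₘ) + Σₖ aₖ • vₖ)`
proves, for every `L ≥ 3` with `x ↦ x mod L` injective on `thicken Λ' 1` and every `n ≤ L²`,
`c − Σₖ ‖aₖ‖ + (Σ_σ μ_σ)(n/L² − ν) ≤ groundEnergyAt (fermionTorusGraph 2 L) t U (2n) / L²`.
Han 2020 §3 (all square-lattice constraints `T_(1,0), T_(0,1), Π, R`, `F[[H,O]] = 0`, `F[n_x] = n`).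
[cite: Han2020Bootstrap, §3] -/
theorem groundEnergyAt_div_ge_of_window_certificate_d4 (t U : ℝ) (hL : 3 ≤ L) {nh : ℕ}
    (hn : nh ≤ Fintype.card (FermionTorus 2 L))
    {Λ Λ' : Finset (Site 2)} (hΛ : Λ ⊆ Λ')
    (hclosed : ∀ x ∈ Λ, ∀ i : Fin 2, x + unitVec i ∈ Λ' ∧ x - unitVec i ∈ Λ')
    (h0 : thicken ({0} : Finset (Site 2)) 1 ⊆ Λ') (hz : (0 : Site 2) ∈ Λ')
    (hInj : Set.InjOn (Torus.proj (d := 2) L) ↑(thicken Λ' 1))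
    (μ : Fin 2 → ℝ) (ν : ℝ)
    {m : Type*} [Fintype m] [DecidableEq m] {Λm : Matrix m m ℂ} (hΛm : Λm.PosSemidef)
    (O : m → FermionOp Λ')
    {κ : Type*} (s : Finset κ) (B : κ → FermionOp Λ)
    {ι : Type*} (tt : Finset ι) (γ : ι → DihedralGroup 4) (wv : ι → Site 2)
    (hsh : ∀ l, d4ShiftSet (γ l) (wv l) Λ ⊆ Λ') (Y : ι → FermionOp Λ)
    {ρ : Type*} (u : Finset ρ) (b : ρ → ℂ) (cw : ρ → List (Orb (PolySite Λ') × Bool))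
    (hcw : ∀ j ∈ u, ladderCharge (cw j) ≠ 0 ∨ ladderSpinCharge (cw j) ≠ 0)
    {δ : Type*} (ah : Finset δ) (dc : δ → ℝ) (V : δ → FermionOp Λ')
    {κ'' : Type*} (w : Finset κ'') (a : κ'' → ℂ) (word : κ'' → List (Orb (PolySite Λ') × Bool)) {c : ℝ}
    (hcert : fermionEmbed (PolySite.incl h0) ((hubbardFermionInteraction 2 t U).meanEnergyObs 1) -
        (c : ℂ) • (1 : FermionOp Λ') -
        ∑ σ : Fin 2, ((μ σ : ℝ) : ℂ) • (nAt 0 hz σ - ((ν : ℝ) : ℂ) • (1 : FermionOp Λ')) =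
      gramForm Λm O +
        (∑ k ∈ s, ((hubbardFermionInteraction 2 t U).localHamiltonian Λ' * fermionEmbed (PolySite.incl hΛ) (B k) -
            fermionEmbed (PolySite.incl hΛ) (B k) * (hubbardFermionInteraction 2 t U).localHamiltonian Λ') +
          ∑ l ∈ tt, (fermionEmbed (PolySite.incl (hsh l)) (fermionEmbed (PolySite.d4Emb (γ l) (wv l) Λ) (Y l)) -
            fermionEmbed (PolySite.incl hΛ) (Y l)) +
          ∑ j ∈ u, b j • ladderWord (cw j)) +
        (∑ m' ∈ ah, ((dc m' : ℝ) : ℂ) • ((V m')ᴴ - V m') + ∑ k ∈ w, a k • ladderWord (word k))) :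
    c - ∑ k ∈ w, ‖a k‖ + (∑ σ : Fin 2, μ σ) * ((nh : ℝ) / (L : ℝ) ^ 2 - ν) ≤
      groundEnergyAt (fermionTorusGraph 2 L) t U (2 * nh) / (L : ℝ) ^ 2 := by
  have hInj' : Set.InjOn (Torus.proj (d := 2) L) ↑Λ' := hInj.mono (by exact_mod_cast subset_thicken Λ' 1)
  have hInjΛ : Set.InjOn (Torus.proj (d := 2) L) ↑Λ := hInj'.mono (by exact_mod_cast hΛ)
  have hInj0 : Set.InjOn (Torus.proj (d := 2) L) ↑(thicken ({0} : Finset (Site 2)) 1) :=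
    hInj'.mono (by exact_mod_cast h0)
  set Γ' := fermionEmbed (PolySite.toTorusEmb L hInj') with hΓ'
  set ΓΛ := fermionEmbed (PolySite.toTorusEmb L hInjΛ) with hΓΛ
  set H := hubbardTorus 2 L t U with hH
  set EΦ := (hubbardFermionInteraction 2 t U).meanEnergyObs 1 with hEΦ
  set X := Γ' (fermionEmbed (PolySite.incl h0) EΦ) with hX
  have hX0 : X = fermionEmbed (PolySite.toTorusEmb L hInj0) EΦ := fermionEmbed_toTorusEmb_incl h0 hInj' EΦ
  have hsum : ∑ v' : TorusSite 2 L, (fockTranslate v').val * X * (fockTranslate v').valᴴ = H := by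
    rw [hX0]
    have h := sum_relabel_translate_hubbard_meanEnergyObs (d := 2) t U hL
    simp_rw [relabel_eq_fockRelabel_conj] at h
    exact h
  set D : Fin 2 → Matrix (Finset (Orb (FermionTorus 2 L))) (Finset (Orb (FermionTorus 2 L))) ℂ :=
    fun σ => numberOp (FermionTorus.ofTorusSite (0 : TorusSite 2 L)) σ with hD
  set G : Fin 2 → Matrix (Finset (Orb (FermionTorus 2 L))) (Finset (Orb (FermionTorus 2 L))) ℂ :=
    fun σ => ∑ y : FermionTorus 2 L, numberOp y σ with hG
  have hDΓ : ∀ σ, Γ' (nAt 0 hz σ) = D σ := fun σ => fermionEmbed_toTorusEmb_nAt_zero hz hInj' σ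
  have hDsum : ∀ σ ∈ (Finset.univ : Finset (Fin 2)),
      ∑ v' : TorusSite 2 L, (fockTranslate v').val * D σ * (fockTranslate v').valᴴ = G σ :=
    fun σ _ => sum_conj_fockTranslate_numberOp 0 σ
  have hGh : ∀ σ ∈ (Finset.univ : Finset (Fin 2)), (G σ).IsHermitian := fun σ _ => isHermitian_sum_numberOp σ
  have hGs : ∀ σ ∈ (Finset.univ : Finset (Fin 2)),
      ∀ ψ ∈ (szSector (2 * nh) 0 : Submodule ℂ (Fock (Orb (FermionTorus 2 L)))),
        G σ *ᵥ ψ = (((nh : ℝ) : ℝ) : ℂ) • ψ := by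
    intro σ _ ψ hψ
    rw [hG, spinNumber_mulVec_of_mem_szSector σ hψ]
    congr 1
    push_cast
    ring
  -- symmetry family: affine `D₄` maps
  set Us : ι → Matrix (Finset (Orb (FermionTorus 2 L))) (Finset (Orb (FermionTorus 2 L))) ℂ :=
    fun l => (fockTranslate (Torus.proj L (wv l))).val * (fockD4 (L := L) (γ l)).val with hUs
  set Yt : ι → Matrix (Finset (Orb (FermionTorus 2 L))) (Finset (Orb (FermionTorus 2 L))) ℂ :=
    fun l => ΓΛ (Y l) with hYt
  have hU : ∀ l ∈ tt, Us l * H = H * Us l := fun l _ => d4Affine_mul_hubbardTorus _ _ t U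
  have hUK : ∀ l ∈ tt, ∀ ψ ∈ (szSector (2 * nh) 0 : Submodule ℂ (Fock (Orb (FermionTorus 2 L)))),
      Us l *ᵥ ψ ∈ (szSector (2 * nh) 0 : Submodule ℂ (Fock (Orb (FermionTorus 2 L)))) :=
    fun l _ ψ hψ => d4Affine_mulVec_mem_szSector _ _ hψ
  have hUK' : ∀ l ∈ tt, ∀ ψ ∈ (szSector (2 * nh) 0 : Submodule ℂ (Fock (Orb (FermionTorus 2 L)))),
      (Us l)ᴴ *ᵥ ψ ∈ (szSector (2 * nh) 0 : Submodule ℂ (Fock (Orb (FermionTorus 2 L)))) :=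
    fun l _ ψ hψ => d4Affine_conjTranspose_mulVec_mem_szSector _ _ hψ
  have hUU : ∀ l ∈ tt, (Us l)ᴴ * Us l = 1 := fun l _ => d4Affine_conjTranspose_mul_self _ _
  -- charge family
  set emb : Orb (PolySite Λ') × Bool → Orb (FermionTorus 2 L) × Bool :=
    fun p => (Orb.embMap (PolySite.toTorusEmb L hInj') p.1, p.2) with hemb
  set C : ρ → Matrix (Finset (Orb (FermionTorus 2 L))) (Finset (Orb (FermionTorus 2 L))) ℂ :=
    fun j => if ladderCharge ((cw j).map emb) ≠ 0 then totalNumber else HubbardWave0.spinZ with hC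
  set W : ρ → Matrix (Finset (Orb (FermionTorus 2 L))) (Finset (Orb (FermionTorus 2 L))) ℂ :=
    fun j => (b j / (if ladderCharge ((cw j).map emb) ≠ 0 then ((ladderCharge ((cw j).map emb) : ℤ) : ℂ)
      else ((ladderSpinCharge ((cw j).map emb) : ℤ) : ℂ) / 2)) • ladderWord ((cw j).map emb) with hW
  have hHc := hamiltonian_isHermitian_and_commute_holds (fermionTorusGraph 2 L) t U
  have hC1 : ∀ j ∈ u, C j * H = H * C j := by
    intro j _
    by_cases hq : ladderCharge ((cw j).map emb) ≠ 0
    · simp only [hC, hq, ne_eq, not_false_eq_true, if_true]; exact hHc.2.1.symm.eq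
    · simp only [hC, hq, if_false]; exact hHc.2.2.symm.eq
  have hCK : ∀ j ∈ u, ∀ ψ ∈ (szSector (2 * nh) 0 : Submodule ℂ (Fock (Orb (FermionTorus 2 L)))),
      C j *ᵥ ψ ∈ (szSector (2 * nh) 0 : Submodule ℂ (Fock (Orb (FermionTorus 2 L)))) := by
    intro j _ ψ hψ
    obtain ⟨hNψ, hSψ⟩ := (mem_szSector_iff _ _ ψ).1 hψ
    by_cases hq : ladderCharge ((cw j).map emb) ≠ 0
    · simp only [hC, hq, ne_eq, not_false_eq_true, if_true]
      rw [totalNumber_mulVec_of_isNParticle hNψ]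
      exact Submodule.smul_mem _ _ hψ
    · simp only [hC, hq, if_false]
      rw [hSψ]
      exact Submodule.smul_mem _ _ hψ
  have hCh : ∀ j, (C j)ᴴ = C j := by
    intro j
    by_cases hq : ladderCharge ((cw j).map emb) ≠ 0
    · simp only [hC, hq, ne_eq, not_false_eq_true, if_true]
      rw [totalNumber_eq_numberDiag_univ]
      exact numberDiag_conjTranspose _
    · simp only [hC, hq, if_false]; exact HubbardWave0.spinZ_isHermitian.eq
  have hCK' : ∀ j ∈ u, ∀ ψ ∈ (szSector (2 * nh) 0 : Submodule ℂ (Fock (Orb (FermionTorus 2 L)))),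
      (C j)ᴴ *ᵥ ψ ∈ (szSector (2 * nh) 0 : Submodule ℂ (Fock (Orb (FermionTorus 2 L)))) :=
    fun j hj ψ hψ => by rw [hCh j]; exact hCK j hj ψ hψ
  have hcharged : ∀ j ∈ u, Γ' (b j • ladderWord (cw j)) = C j * W j - W j * C j := by
    intro j hj
    rw [map_smul, hΓ', fermionEmbed_ladderWord]
    have hl : ladderCharge ((cw j).map emb) ≠ 0 ∨ ladderSpinCharge ((cw j).map emb) ≠ 0 := by
      rw [hemb, ladderCharge_map_embMap, ladderSpinCharge_map_embMap]; exact hcw j hj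
    exact smul_ladderWord_eq_commutator_of_charged (b j) _ hl
  -- residual words
  set M : κ'' → Matrix (Finset (Orb (FermionTorus 2 L))) (Finset (Orb (FermionTorus 2 L))) ℂ :=
    fun k => ladderWord ((word k).map emb) with hM
  have hMc : ∀ k ∈ w, (M k).IsContraction := fun k _ => by
    rw [hM]; dsimp only; rw [ladderWord_eq_prod]; exact isContraction_prod_ladder _
  -- the identity, pulled back into the torus
  have htorus : X - (c : ℂ) • (1 : Matrix (Finset (Orb (FermionTorus 2 L))) (Finset (Orb (FermionTorus 2 L))) ℂ) -
      ∑ σ ∈ (Finset.univ : Finset (Fin 2)), ((μ σ : ℝ) : ℂ) • (D σ - ((ν : ℝ) : ℂ) •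
        (1 : Matrix (Finset (Orb (FermionTorus 2 L))) (Finset (Orb (FermionTorus 2 L))) ℂ)) =
      gramForm Λm (fun i => Γ' (O i)) +
        (∑ k ∈ s, (H * Γ' (fermionEmbed (PolySite.incl hΛ) (B k)) - Γ' (fermionEmbed (PolySite.incl hΛ) (B k)) * H) +
          ∑ l ∈ tt, (Us l * Yt l * (Us l)ᴴ - Yt l) +
          ∑ i ∈ (∅ : Finset (Fin 0)), ((0 : Matrix _ _ ℂ) * ((0 : Matrix _ _ ℂ) - (((0 : ℝ) : ℝ) : ℂ) • 1) +
            ((0 : Matrix _ _ ℂ) - (((0 : ℝ) : ℝ) : ℂ) • 1) * (0 : Matrix _ _ ℂ)) +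
          ∑ j ∈ u, (C j * W j - W j * C j)) +
        (∑ m' ∈ ah, ((dc m' : ℝ) : ℂ) • ((Γ' (V m'))ᴴ - Γ' (V m')) + ∑ k ∈ w, a k • M k) := by
    have key := congrArg Γ' hcert
    rw [map_sub, map_sub, map_smul, map_one, map_sum] at key
    have hlhs : ∑ σ : Fin 2, Γ' (((μ σ : ℝ) : ℂ) • (nAt 0 hz σ - ((ν : ℝ) : ℂ) • (1 : FermionOp Λ'))) =
        ∑ σ ∈ (Finset.univ : Finset (Fin 2)), ((μ σ : ℝ) : ℂ) • (D σ - ((ν : ℝ) : ℂ) •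
          (1 : Matrix (Finset (Orb (FermionTorus 2 L))) (Finset (Orb (FermionTorus 2 L))) ℂ)) :=
      Finset.sum_congr rfl fun σ _ => by rw [map_smul, map_sub, map_smul, map_one, hDΓ]
    rw [hlhs] at key
    have h1 : Γ' (∑ k ∈ s, ((hubbardFermionInteraction 2 t U).localHamiltonian Λ' * fermionEmbed (PolySite.incl hΛ) (B k) -
        fermionEmbed (PolySite.incl hΛ) (B k) * (hubbardFermionInteraction 2 t U).localHamiltonian Λ')) =
        ∑ k ∈ s, (H * Γ' (fermionEmbed (PolySite.incl hΛ) (B k)) - Γ' (fermionEmbed (PolySite.incl hΛ) (B k)) * H) := by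
      rw [map_sum]
      refine Finset.sum_congr rfl fun k _ => ?_
      rw [hH, hΓ', hubbardTorus_commutator_fermionEmbed L t U hΛ hclosed hInj (B k)]
    have h2 : Γ' (∑ l ∈ tt, (fermionEmbed (PolySite.incl (hsh l)) (fermionEmbed (PolySite.d4Emb (γ l) (wv l) Λ) (Y l)) -
        fermionEmbed (PolySite.incl hΛ) (Y l))) = ∑ l ∈ tt, (Us l * Yt l * (Us l)ᴴ - Yt l) := by
      rw [map_sum]
      refine Finset.sum_congr rfl fun l _ => ?_
      rw [hUs, hYt, hΓΛ, hΓ']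
      exact fermionEmbed_toTorusEmb_d4_sub hΛ (γ l) (wv l) (hsh l) hInj' (Y l)
    have h3 : Γ' (∑ j ∈ u, b j • ladderWord (cw j)) = ∑ j ∈ u, (C j * W j - W j * C j) := by
      rw [map_sum]
      exact Finset.sum_congr rfl hcharged
    have h4 : Γ' (∑ m' ∈ ah, ((dc m' : ℝ) : ℂ) • ((V m')ᴴ - V m')) =
        ∑ m' ∈ ah, ((dc m' : ℝ) : ℂ) • ((Γ' (V m'))ᴴ - Γ' (V m')) := by
      rw [map_sum]
      refine Finset.sum_congr rfl fun m' _ => ?_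
      rw [map_smul, map_sub, hΓ', fermionEmbed_conjTranspose]
    have h5 : Γ' (∑ k ∈ w, a k • ladderWord (word k)) = ∑ k ∈ w, a k • M k := by
      rw [map_sum]
      refine Finset.sum_congr rfl fun k _ => ?_
      rw [map_smul, hM, hΓ', fermionEmbed_ladderWord]
    rw [hX, key, map_add, map_add, map_add, map_add, map_add, hΓ', fermionEmbed_gramForm, ← hΓ', h1, h2, h3, h4, h5,
      Finset.sum_empty, add_zero]
  have hmain := hubbardTorus_groundEnergyAt_div_ge_of_local_certificate t U hn X hsum
    (Finset.univ : Finset (Fin 2)) μ (fun _ => ν) (fun _ => (nh : ℝ)) D G hDsum hGh hGs hΛm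
    (fun i => Γ' (O i)) s (fun k => Γ' (fermionEmbed (PolySite.incl hΛ) (B k))) tt Us Yt hU hUK hUK' hUU
    (∅ : Finset (Fin 0)) (fun _ => 0) (fun _ => 0) (fun _ => 0) (fun _ => 0)
    (fun i hi => absurd hi (Finset.notMem_empty i)) (fun i hi => absurd hi (Finset.notMem_empty i))
    u C W hC1 hCK hCK' ah dc (fun m' => Γ' (V m')) w a M hMc htorus
  have hs : ∑ σ ∈ (Finset.univ : Finset (Fin 2)), μ σ * ((nh : ℝ) / (L : ℝ) ^ 2 - ν) =
      (∑ σ : Fin 2, μ σ) * ((nh : ℝ) / (L : ℝ) ^ 2 - ν) := by rw [Finset.sum_mul]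
  rw [hs] at hmain
  exact hmain

/-- **Window certificate with affine `D₄` reductions ⇒ thermodynamic-limit energy density of the
square-lattice Hubbard model**: with the data of `groundEnergyAt_div_ge_of_window_certificate_d4` and
target density `n ∈ [0,2)` (`ν = n/2`, `U ≥ 0`), `c − Σₖ ‖aₖ‖ ≤ energyDensity2D t U n`. This is the
soundness statement for Han's 2D thermodynamic-limit bootstrap with its full constraint set
(positivity, `F[[H,O]] = 0`, `U(1)×U(1)` charges, translations, `Π`, `R`, density), in certified
form. [cite: Han2020Bootstrap, §3] -/
theorem energyDensity2D_ge_of_window_certificate_d4 (t : ℝ) {U : ℝ} (hU : 0 ≤ U) {n : ℝ} (hn0 : 0 ≤ n)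
    (hn2 : n < 2)
    {Λ Λ' : Finset (Site 2)} (hΛ : Λ ⊆ Λ')
    (hclosed : ∀ x ∈ Λ, ∀ i : Fin 2, x + unitVec i ∈ Λ' ∧ x - unitVec i ∈ Λ')
    (h0 : thicken ({0} : Finset (Site 2)) 1 ⊆ Λ') (hz : (0 : Site 2) ∈ Λ')
    (μ : Fin 2 → ℝ)
    {m : Type*} [Fintype m] [DecidableEq m] {Λm : Matrix m m ℂ} (hΛm : Λm.PosSemidef)
    (O : m → FermionOp Λ')
    {κ : Type*} (s : Finset κ) (B : κ → FermionOp Λ)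
    {ι : Type*} (tt : Finset ι) (γ : ι → DihedralGroup 4) (wv : ι → Site 2)
    (hsh : ∀ l, d4ShiftSet (γ l) (wv l) Λ ⊆ Λ') (Y : ι → FermionOp Λ)
    {ρ : Type*} (u : Finset ρ) (b : ρ → ℂ) (cw : ρ → List (Orb (PolySite Λ') × Bool))
    (hcw : ∀ j ∈ u, ladderCharge (cw j) ≠ 0 ∨ ladderSpinCharge (cw j) ≠ 0)
    {δ : Type*} (ah : Finset δ) (dc : δ → ℝ) (V : δ → FermionOp Λ')
    {κ'' : Type*} (w : Finset κ'') (a : κ'' → ℂ) (word : κ'' → List (Orb (PolySite Λ') × Bool)) {c : ℝ}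
    (hcert : fermionEmbed (PolySite.incl h0) ((hubbardFermionInteraction 2 t U).meanEnergyObs 1) -
        (c : ℂ) • (1 : FermionOp Λ') -
        ∑ σ : Fin 2, ((μ σ : ℝ) : ℂ) • (nAt 0 hz σ - ((n / 2 : ℝ) : ℂ) • (1 : FermionOp Λ')) =
      gramForm Λm O +
        (∑ k ∈ s, ((hubbardFermionInteraction 2 t U).localHamiltonian Λ' * fermionEmbed (PolySite.incl hΛ) (B k) -
            fermionEmbed (PolySite.incl hΛ) (B k) * (hubbardFermionInteraction 2 t U).localHamiltonian Λ') +
          ∑ l ∈ tt, (fermionEmbed (PolySite.incl (hsh l)) (fermionEmbed (PolySite.d4Emb (γ l) (wv l) Λ) (Y l)) -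
            fermionEmbed (PolySite.incl hΛ) (Y l)) +
          ∑ j ∈ u, b j • ladderWord (cw j)) +
        (∑ m' ∈ ah, ((dc m' : ℝ) : ℂ) • ((V m')ᴴ - V m') + ∑ k ∈ w, a k • ladderWord (word k))) :
    c - ∑ k ∈ w, ‖a k‖ ≤ ThermodynamicLimit.energyDensity2D t U n := by
  obtain ⟨L₀, hL₀⟩ := exists_forall_le_injOn_proj (thicken Λ' 1)
  refine ThermodynamicLimit.energyDensity2D_ge_of_eventually_ge_torus t hU hn0 hn2
    (μ := (∑ σ : Fin 2, μ σ) / 2) ?_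
  filter_upwards [Filter.eventually_ge_atTop (max L₀ 3)] with L hL
  have hL3 : 3 ≤ L := le_trans (le_max_right _ _) hL
  have hLL : L₀ ≤ L := le_trans (le_max_left _ _) hL
  haveI : NeZero L := ⟨by omega⟩
  set nh : ℕ := ⌊n * (L : ℝ) ^ 2 / 2⌋₊ with hnh
  have hrect : ThermodynamicLimit.rectN n L = 2 * nh := rfl
  have hn : nh ≤ Fintype.card (FermionTorus 2 L) := by
    have h := ThermodynamicLimit.rectN_le_two_mul hn0 hn2.le L
    rw [hrect] at h
    have hcard : Fintype.card (FermionTorus 2 L) = L ^ 2 := by simp [FermionTorus]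
    rw [hcard, sq]
    omega
  have hmain := groundEnergyAt_div_ge_of_window_certificate_d4 t U hL3 hn hΛ hclosed h0 hz (hL₀ L hLL) μ (n / 2)
    hΛm O s B tt γ wv hsh Y u b cw hcw ah dc V w a word hcert
  have key : c - ∑ k ∈ w, ‖a k‖ + (∑ σ : Fin 2, μ σ) / 2 * ((((2 * nh : ℕ) : ℝ)) / (L : ℝ) ^ 2 - n) =
      c - ∑ k ∈ w, ‖a k‖ + (∑ σ : Fin 2, μ σ) * ((nh : ℝ) / (L : ℝ) ^ 2 - n / 2) := by
    push_cast
    ring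
  rw [hrect, key]
  exact hmain

end Window

end Literature.MathematicalPhysics.QuantumLattice
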